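/-
R90-TF S5 — crux H413 = `stmt-HodgeConjecture-24833`.  Lines file `Cruxes/H413/Lines/R90_S5_ArchJLettersA3.lean` — the §A3 LETTERS of the `₃` road, downstream of A
(RULINGS S5-R8 ∕ R11 ∕ R12 ∕ R13 ∕ R16 ∕ R18).  EDITION LOG: ED. 1 (wave 2, S5-R16 ∕ R18; dealer R90-C133-plan (g3) byte 2026-09-05T02:24:20Z «A4 = (i) — NEW Lines file; tree A
STAYS ED. 3 f57d6280 byte for byte»; staged by R90-C133-p03 (g3), deal (H15); lit4 (1929) cite-digit riders folded; written by registrar pen #1).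
-/
import Summits.HodgeConjecture.HodgeConjecture.Cruxes.H413.Lines.R90_S5_BaseChangeSpineA   -- S5-A ED. 3 (tree f57d6280d56a212a, BUILT): `XiMembershipOfArchJLetter₃` (:221), `stub_R90_1336c_membership₃` (:254, the ON-PATH socket), the trigger currency
import Summits.HodgeConjecture.HodgeConjecture.Cruxes.H413.Lines.R90_S5_GOfRecordC2       -- S5-C2 ED. 2c (tree 9454a663ac0c84bb, BUILT): `PacketGOfRecord 𝔩 𝔞 μ Pk` (via S5-C), `GlobalPacketH.rhoXiU` ∕ `imageG` (via ★ p863612)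
import Summits.HodgeConjecture.HodgeConjecture.Theorems.R90S5OccGOfRecord                 -- ★ p864324 `R90.S5.OccGOfRecord L ι μ π c` (the (β) trigger export's occurrence predicate, token at ★ `R90.S2.qsFrame`)
import Summits.HodgeConjecture.HodgeConjecture.Theorems.R90S9InnerFormSec146Packets        -- ★ S9 §8 `InnerFormSec146.evpRepOf L H μ 𝔩 P Pg` (THE e.v.p. token, JQ-S5→S9-4 FINAL (a))
import Summits.HodgeConjecture.HodgeConjecture.Theorems.R90S5EvpTransportAe                -- ★ p864229 (T1) `evpRepOf_of_eventuallyEq_loc` (`t(P) = t(Π)` transports along `Π =ᵃᵉ Π′`)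
import HarnessLib

/-!
# R90-TF S5 SPINE, file A3 «THE LETTERS OF THE TWO-PLACE ROAD» — `EvpMatch₀`, (α) `InnerFormEvpMatchLetter₃At`, (β) `QsArchJExhaustionLetter₃At`, (γ) `InnerFormATransportLetter₃At`
# (POINTWISE FRAME-PARAMETRIC `…At`, S5-R18 ∕ J-A3-REC), the socket-facing `ArchJLettersAtSomeFrame₃` and the PROVED composition `xiMembershipOfArchJ₃_of_letters :
# ArchJLettersAtSomeFrame₃ → XiMembershipOfArchJLetter₃` (Rogawski 1990, Thm. 13.3.6 (c) p. 202; §14.6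
# (14.6.2) p. 242, Prop. 14.6.2, Thm. 14.6.4 pp. 243–244; §15.3 ¶1 p. 249)

Cell `hodgecm-mathlib`, crux H413 = `stmt-HodgeConjecture-24833`, route `HCCMUnconditional`; R90-TF section S5 «Ch13.3-mult∕rigidity» (R90-C133); dealer R90-C133-plan (g3) deal (H15)
«STAGE THE A ED. 4 CAND» + RULING S5-R18; staged by R90-C133-p03 (g3) 2026-09-05.  WHY A NEW FILE AND NOT A ED. 4: the four imports the letters need (C2, ★ `R90S5OccGOfRecord`,
★ S9 §8, ★ p864229) bring `NumberField.ideleGroup` (HodgeCM `PerL34.IdeleClassGroup`) into A's scope, where A's FROZEN ED. 1–3 bodies spell `ideleGroup ↥(maximalRealSubfield L)`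
under `open NumberField` + `open Literature.NumberTheory.GaloisRepresentations` ⇒ «Ambiguous term `ideleGroup`» at :139 ∕ :180 ∕ :235 (farm-verified on the additions-only cand
`R90/R90-C133-p03/g3/aed4/R90_S5_BaseChangeSpineA.ed4-cand.lean`): an edition of A cannot take these imports without editing frozen bytes.  The dealer's pre-ruled fallback
(S5-R13, typ1 deal: «new file `R90_S5_ArchJLettersA3.lean` imports A») is therefore taken: A stays ED. 3 byte for byte; this file spells `…GaloisRepresentations.ideleGroup` in full.
CONSEQUENCE for :254: its payer is a DOWNSTREAM, LINES-SIDE file (dealer byte 02:24:20Z: candidate = the Index edition importing this file + the socket homes and proving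
`xiMembershipOfArchJ₃_of_record := xiMembershipOfArchJ₃_of_letters ‹record frame› sockα sockβ sockγ`; A ED. 5 ∕ the registry handling of :254 is ruled then), never an edition of A
importing this file (cycle).
STATEMENT LAYER + ONE PROVED THEOREM: three POINTWISE `def … : Prop` letters `…At` (FRAME-PARAMETRIC AT THE FINEST GRAIN, v3 ∕ J-A3-REC: stated for ONE `L` at ONE frame — kit
`𝔩 : ∀ v, LocalPacketKit L (splitForm L 3) v`, (ℓ8ᵁ) `h8U`, `hunrU`, arch kit `𝔞`, quasi-split automorphic measure `μqs`, A-packet family `Pk` — given as explicit ARGUMENTS, since the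
kit of record `rogawskiLocalKit L v μω …` depends on `μω` and on non-closed transfer data), the socket-facing `def ArchJLettersAtSomeFrame₃` («per datum, SOME frame carries the three
letters»), the token `abbrev EvpMatch₀`, the composition (no sorry, TRIO) and the `H¹`-trigger read-back of (G∞)₃.  NO socket in this file (S5-R16 (7): the letters are DEFINITIONS; their payers are theorems proving them at the FRAME OF RECORD — `𝔩 :=` S4's
`rogawskiLocalKit` family with (ℓ8ᵁ) ∕ (unr-a.e.), `𝔞 :=` ★ S2 `rogawskiArchKit`, `Pk := transportAPackets 𝔨.ψ Ξ₀` (S5-R15): (α) S9's, (β) S5's ★ p864086 + ★ p864229 (T2) mod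
rows `h1336cArch` [D ED. 5 `stub_R90_1336c_qsArchMembership` via ★ p864376] ∕ `hSph` [S4-10] ∕ `hDiscXi` [C2 ★], (γ) ★ p864272 mod `hEvpXi` [S4-11] ∕ `hRigXi` [S9 organ ← ★ p864181]).
Reads NO archimedean packet slot (LAW NO-INF): `Q : PacketGOfRecord …` enters through `Q.1.fin` only.  GREEN CONTRACT: rc 0, errors [], warnings [], sorries 0 in THIS file
(A's two sockets :160 ∕ :254 live in A); `--axioms xiMembershipOfArchJ₃_of_letters` = TRIO.
HONEST LABEL: HC_CM is proved only modulo the 7 printed citations (2 remaining named inputs: hLiu418 = stmt-HodgeConjecture-24832, h413 = stmt-HodgeConjecture-24833) until rung 0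
closes; this file types letters and proves their composition — it pays no socket (S5 ON-PATH code-sorries 4 ∕ OFF-PATH 1 unchanged).

References: [Rogawski1990] J. Rogawski, *Automorphic representations of unitary groups in three variables*, Ann. of Math. Stud. 123 (1990): §12.3 p. 178; §13.3 pp. 201–203
(Thm. 13.3.3 (c), 13.3.5, 13.3.6 (c), 13.3.7); §13.7 pp. 210–212; §14.6 pp. 241–246 (Thm. 14.6.1, (14.6.2), Prop. 14.6.2, Thm. 14.6.4–14.6.5); §15.3 ¶1 p. 249; Prop. 15.2.1 (b) p. 250.
[BorelWallach2000] A. Borel, N. Wallach, *Continuous cohomology, discrete subgroups, and representations of reductive groups*, 2nd ed. (2000), VI Thm. 4.11.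
-/

-- Mathlib idiom (as in A ∕ ★ `GlobalAPacketLetters`): the commutator bracket on `Module.End ℂ M`, needed to MENTION `(uFormGroup (Fin 2) (Fin 1)).lie →ₗ⁅ℝ⁆ Module.End ℂ M`.
attribute [local instance 100] LieRing.ofAssociativeRing

set_option autoImplicit false
set_option linter.dupNamespace false

noncomputable section

open NumberField IsDedekindDomain MeasureTheory Filter
open scoped Matrix ComplexOrder

namespace Summit.HodgeConjecture.HodgeConjecture.R90.S5

open Literature.NumberTheory.Automorphic Literature.NumberTheory.Automorphic.UnitaryGroup
open Literature.NumberTheory.Automorphic.UnitaryGroup.CotangentForms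
open Literature.NumberTheory.Rogawski1990
-- A's `open Literature.NumberTheory.GaloisRepresentations` MINUS `ideleGroup`: the C2 ∕ S9 ∕ E1 import cones bring `NumberField.ideleGroup` (HodgeCM `PerL34.IdeleClassGroup`) into
-- scope, so the unqualified token would be ambiguous here; this file spells `Literature.NumberTheory.GaloisRepresentations.ideleGroup` in full (the spelling A's ED. 1–3 letters denote).
open Literature.NumberTheory.GaloisRepresentations hiding ideleGroup
open Literature.RepresentationTheory Literature.RepresentationTheory.BorelWallach2000
open Literature.RepresentationTheory.KonnoKonno2007
open Summit.HodgeConjecture.HodgeConjecture.Cruxes.H413.F0P3bArchDegOnePackage (IsCohUnitaryIrrep)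
open Summit.HodgeConjecture.HodgeConjecture.Cruxes.H413.F0P3bArchDegOneClass (archDegOneClass ofModule_eq_archDegOneClass archDegOneClass_spec)

/-! ## §1 THE A3 LETTERS OF THE `₃` ROAD — token `EvpMatch₀`, the POINTWISE FRAME-PARAMETRIC letters (α) ∕ (β) ∕ (γ) at `Occ := OccGOfRecord`, the socket-facing
existential-frame hypothesis `ArchJLettersAtSomeFrame₃`, and the PROVED composition
(RULINGS S5-R8 (three letters), S5-R11 (LAW NO-INF; (R-occ)), S5-R12 (token = ★ S9 `evpRepOf`; (γ) rows), S5-R13 «AE-CUT» ((β) a.e. form, (γ) Q-free image form, (α) `∃`, 13.3.5 off the road),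
S5-R16 («OccG HOME = ★»; wave 2; NO new socket in A), S5-R18 «LETTERS ARE FRAME-PARAMETRIC» (a closed `∀ kit` letter is refutable by a junk `LocalPacketKit`, hence unpayable: the
C2 frame — kit `𝔩` over `Φ₃`, (ℓ8ᵁ) `h8U`, `hunrU`, arch kit `𝔞`, quasi-split automorphic measure `μqs`, A-packet family `Pk` — is an explicit ARGUMENT of each letter)).
ED. 1 v3 «POINTWISE LETTERS» (J-A3-REC, 02:32Z): the frame is taken PER DATUM — each letter is stated for ONE CM field `L` (and, for (γ), one `μω`) at ONE frame
`(𝔩, h8U, hunrU, 𝔞, μqs, Pk)` over that `L` — because the kit of record `R90.S4.rogawskiLocalKit L v μω νG νH Δ mH mG` (S4-A :431) depends on `μω` (bound INSIDE A's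
₃-prefix) and on transfer data that are not closed terms (D's sockets quantify them with law rows; D's records are existential): a closed per-`L` Pi-family `𝔩 : ∀ L v, …`
could never be instantiated at the record.  The composition therefore consumes `ArchJLettersAtSomeFrame₃` — «for every datum of the ₃-prefix up to `hμω`, SOME frame carries
the three letters» — which closed families, `Classical.choice` from existence theorems, and D-style closed-∀-frame sockets over an `Hrec`-style record all feed alike.
NEW FILE downstream of A (A ED. 3 f57d6280 is NOT edited: importing the C2 ∕ S9 ∕ E1 cones INTO A makes A's frozen `ideleGroup` tokens ambiguous — `NumberField.ideleGroup` vs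
`Literature.NumberTheory.GaloisRepresentations.ideleGroup` — so the dealer's pre-ruled fallback «new file imports A» (S5-R13 typ1 deal; byte 02:24:20Z (i)) is taken); NO `sorry`
in this file; the three letters are DEFINITIONS (their payers land as theorems proving them at the frame of record: `𝔩 v := rogawskiLocalKit L v μω …` with (ℓ8ᵁ) ∕ (unr-a.e.),
`𝔞 := ` ★ S2 `rogawskiArchKit`, `Pk := transportAPackets 𝔨.ψ Ξ₀` (S5-R15)); `stub_R90_1336c_membership₃` (A :254) is re-paid LATER, Lines-side, by ONE line through
`xiMembershipOfArchJ₃_of_letters` (DAG LAW: D never imports A).  Reads NO archimedean packet slot (LAW NO-INF): `Q : PacketGOfRecord …` enters through `Q.1.fin` only. -/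

section A3Letters

open Summit.HodgeConjecture.HodgeConjecture.Cruxes.H413
open Summit.HodgeConjecture.HodgeConjecture.Cruxes.H413.F0P3LocalPacketKit
open Summit.HodgeConjecture.HodgeConjecture.Cruxes.H413.F0P3GlobalPacket
open Summit.HodgeConjecture.HodgeConjecture.Cruxes.H413.F0P3ArchPacketKit
open Summit.HodgeConjecture.HodgeConjecture.Cruxes.H413.F0P3SpectralPacket
open Summit.HodgeConjecture.HodgeConjecture.Cruxes.H413.F0P3InnerFormClassificationV6 (splitForm)
open Summit.HodgeConjecture.HodgeConjecture.R90.S9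

/-- **THE E.V.P. TOKEN `EvpMatch₀ P Q` — «the e.v.p. `t(P)` coincides with `t(Q)`»** (RULING S5-R12 (1); JQ-S5→S9-4 FINAL (a)): ★ S9 `InnerFormSec146.evpRepOf L H μ 𝔩 P Q.1.fin` BYTE
FOR BYTE — for almost all finite `v`, along every level-matching frame `e : U(Φ₃)_v ≃ U(H)_v`, the chosen local class ★ `clFinChoice P v` pulled back along `e` IS the unramified member
`sph Q_v`; read at S5-C's packet of record through `Q.1.fin` (finite places only; no archimedean slot).  Record: `𝔩 v := rogawskiLocalKit L v μω …`, `Pk := transportAPackets 𝔨.ψ Ξ₀`.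
[cite: Rogawski1990, §14.6 p. 242 ll. 6–8, (14.6.2); §13.7 pp. 210–212] -/
abbrev EvpMatch₀ {L : Type} [Field L] [NumberField L] [IsCMField L] {H : Matrix (Fin 3) (Fin 3) L}
    {μ : Measure (adelicGroupData (↥(maximalRealSubfield L)) L (IsCMField.complexConj L) 3 H).automorphicQuotient}
    [(adelicGroupData (↥(maximalRealSubfield L)) L (IsCMField.complexConj L) 3 H).IsAutomorphicMeasure μ]
    {𝔩 : ∀ v : HeightOneSpectrum (𝓞 ↥(maximalRealSubfield L)), LocalPacketKit L (splitForm L 3) v} {𝔞 : ArchPacketKit} [Nonempty 𝔞.PktInf]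
    {μqs : Measure (adelicGroupData (↥(maximalRealSubfield L)) L (IsCMField.complexConj L) 3 (splitForm L 3)).automorphicQuotient}
    [(adelicGroupData (↥(maximalRealSubfield L)) L (IsCMField.complexConj L) 3 (splitForm L 3)).IsAutomorphicMeasure μqs]
    {Pk : OneDimAutRepH L → ∀ v : HeightOneSpectrum (𝓞 ↥(maximalRealSubfield L)), CMLocalAPacket L (splitForm L 3) v}
    (P : DiscreteAutomorphicRep (adelicGroupData (↥(maximalRealSubfield L)) L (IsCMField.complexConj L) 3 H) μ) (Q : PacketGOfRecord 𝔩 𝔞 μqs Pk) : Prop :=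
  InnerFormSec146.evpRepOf L H μ 𝔩 P Q.1.fin

/-- **(α) `InnerFormEvpMatchLetter₃At L ι H T hT μ 𝔩 𝔞 μqs Pk` — THE E.V.P. MATCH + THE TRIGGER EXPORT, AT ONE FRAME** [§14.6 Thm. 14.6.1, (14.6.2) p. 242 «`t_{S′}` is of the form
`t_{S′}(π)` … if and only if `t_{S′} = t_{S′}(Π)` for some `Π ∈ Π(G)`»; Prop. 14.6.2 ∕ Thm. 14.6.5 (the members of the matched packet OCCUR on `G`, with `P_ι ∈ Q_ι` at `ι ∉ S₀`)] —
OWNER S9 (beneath: S6 (14.5.1 (b)), S3 ∕ LH2 transfers, S10 two-place simple TF, S8): for the CM field `L`, the real place `ι`, the inner form `(H, T, hT)` with automorphic measure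
`μ`, AT THE FRAME `(𝔩, 𝔞, μqs, Pk)` over `Φ₃ = splitForm L 3`: every discrete `P` of `U(H)` whose `ι`-component carries a coh-unitary token of class `[J^δ]` has a packet of record
`Q` of the kit `𝔩` with `EvpMatch₀ P Q` AND a member family `π ∈ Q_f` that OCCURS on `U(Φ₃)` through a discrete `P′` carrying the same token class at `ι` (★ `OccGOfRecord`;
S5-R11 (2) ∕ R13 (3): `∃`, not `∃!`).  FRAME-PARAMETRIC AT THE FINEST GRAIN (S5-R18; J-A3-REC): paid at the frame of record, per `L`.
[cite: Rogawski1990, §14.6 Thm. 14.6.1 p. 241, (14.6.2) p. 242, Prop. 14.6.2 pp. 242–243, Thm. 14.6.4–14.6.5 pp. 243–246; §13.3 Thm. 13.3.5 p. 202; §12.3 p. 178] -/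
def InnerFormEvpMatchLetter₃At (L : Type) [Field L] [NumberField L] [IsCMField L] (ι : L →+* ℂ) (H : Matrix (Fin 3) (Fin 3) L) (T : GL (Fin 3) ℂ)
    (hT : (T : Matrix (Fin 3) (Fin 3) ℂ)ᴴ * H.map ι * (T : Matrix (Fin 3) (Fin 3) ℂ) = Literature.Geometry.ComplexHyperbolic.BallModel.J)
    (μ : Measure (adelicGroupData (↥(maximalRealSubfield L)) L (IsCMField.complexConj L) 3 H).automorphicQuotient)
    [(adelicGroupData (↥(maximalRealSubfield L)) L (IsCMField.complexConj L) 3 H).IsAutomorphicMeasure μ]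
    (𝔩 : ∀ v : HeightOneSpectrum (𝓞 ↥(maximalRealSubfield L)), LocalPacketKit L (splitForm L 3) v) (𝔞 : ArchPacketKit) [Nonempty 𝔞.PktInf]
    (μqs : Measure (adelicGroupData (↥(maximalRealSubfield L)) L (IsCMField.complexConj L) 3 (splitForm L 3)).automorphicQuotient)
    [(adelicGroupData (↥(maximalRealSubfield L)) L (IsCMField.complexConj L) 3 (splitForm L 3)).IsAutomorphicMeasure μqs]
    (Pk : OneDimAutRepH L → ∀ v : HeightOneSpectrum (𝓞 ↥(maximalRealSubfield L)), CMLocalAPacket L (splitForm L 3) v) : Prop :=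
  ∀ (P : DiscreteAutomorphicRep (adelicGroupData (↥(maximalRealSubfield L)) L (IsCMField.complexConj L) 3 H) μ)
    (M : Type) [AddCommGroup M] [Module ℂ M] (σK : Representation ℂ (uFormGroup (Fin 2) (Fin 1)).maximalCompact M)
    (σ𝔤 : (uFormGroup (Fin 2) (Fin 1)).lie →ₗ⁅ℝ⁆ Module.End ℂ M) (hM : IsCohUnitaryIrrep σK σ𝔤),
    (∃ T₁ : P.archModuleCM ι T hT →ₗ[ℂ] M,
      (∀ (k : (uFormGroup (Fin 2) (Fin 1)).maximalCompact) (w : P.archModuleCM ι T hT),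
          T₁ (P.archRepKCM ι T hT k w) = σK k (T₁ w)) ∧
        (∀ (X : (uFormGroup (Fin 2) (Fin 1)).lie) (w : P.archModuleCM ι T hT),
          T₁ (P.archRepLieCM ι T hT X w) = σ𝔤 X (T₁ w)) ∧ T₁ ≠ 0) →
    ∀ (δ : ℤ) (hδ : δ = 1 ∨ δ = -1), GKIrrClass.ofModule M σK σ𝔤 hM.gk hM.irred = archDegOneClass δ hδ →
      ∃ Q : PacketGOfRecord 𝔩 𝔞 μqs Pk, EvpMatch₀ P Q ∧
        ∃ π : ∀ v : HeightOneSpectrum (𝓞 ↥(maximalRealSubfield L)), IrrClass ((cmDatum L 3 (splitForm L 3)).Local v),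
          Q.1.fin.Mem π ∧ OccGOfRecord L ι μqs π (archDegOneClass δ hδ)

/-- **(β) `QsArchJExhaustionLetter₃At L ι 𝔩 h8U 𝔞 μqs Pk` — ARCH-J EXHAUSTION ON THE QUASI-SPLIT GROUP, A.E. FORM, AT ONE FRAME** (S5-R13 (1)) [Thm. 13.3.3 (c); Thm. 13.3.6 (c) at
the real place `ι`; §12.3; §13.3 p. 201 l. 16 `Π_a(G)`] — OWNER S5 (payer = ★ p864086 `ae_liftsTo_of_mem_occ` ∘ ★ p864229 (T2) modulo the rows `h1336cArch` [D ED. 5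
`stub_R90_1336c_qsArchMembership` via ★ p864376 `archRow_h1336c_of_socket`], `hSph` [(ℓ-sphA) S4], `hDiscXi` [C2 ★]): AT THE FRAME `(𝔩, h8U, 𝔞, μqs, Pk)` over `L`, a packet of
record `Q` of `U(Φ₃)` with a member family occurring through a discrete `P′` that carries a coh-unitary token of class `[J^δ]` at `ι` is ALMOST EVERYWHERE the A-packet
`Π(ξ′) = ξ_H({ξ′_v})_v` of some one-dimensional `ξ′` (★ W1 `rhoXiU` under (ℓ8ᵁ) `h8U`).  FRAME-PARAMETRIC AT THE FINEST GRAIN (S5-R18; J-A3-REC).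
[cite: Rogawski1990, §13.3 Thm. 13.3.3 (c), Thm. 13.3.6 (c) p. 202, p. 201 ll. 16–18; §12.3 p. 178; §14.6 Prop. 14.6.2 pp. 242–243] -/
def QsArchJExhaustionLetter₃At (L : Type) [Field L] [NumberField L] [IsCMField L] (ι : L →+* ℂ)
    (𝔩 : ∀ v : HeightOneSpectrum (𝓞 ↥(maximalRealSubfield L)), LocalPacketKit L (splitForm L 3) v)
    (h8U : ∀ v : HeightOneSpectrum (𝓞 ↥(maximalRealSubfield L)), (𝔩 v).OneDimHLawU) (𝔞 : ArchPacketKit) [Nonempty 𝔞.PktInf]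
    (μqs : Measure (adelicGroupData (↥(maximalRealSubfield L)) L (IsCMField.complexConj L) 3 (splitForm L 3)).automorphicQuotient)
    [(adelicGroupData (↥(maximalRealSubfield L)) L (IsCMField.complexConj L) 3 (splitForm L 3)).IsAutomorphicMeasure μqs]
    (Pk : OneDimAutRepH L → ∀ v : HeightOneSpectrum (𝓞 ↥(maximalRealSubfield L)), CMLocalAPacket L (splitForm L 3) v) : Prop :=
  ∀ (Q : PacketGOfRecord 𝔩 𝔞 μqs Pk) (δ : ℤ) (hδ : δ = 1 ∨ δ = -1),
    (∃ π : ∀ v : HeightOneSpectrum (𝓞 ↥(maximalRealSubfield L)), IrrClass ((cmDatum L 3 (splitForm L 3)).Local v),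
        Q.1.fin.Mem π ∧ OccGOfRecord L ι μqs π (archDegOneClass δ hδ)) →
      ∃ ξ' : OneDimAutRepH L, ∀ᶠ v : HeightOneSpectrum (𝓞 ↥(maximalRealSubfield L)) in cofinite,
        Q.1.fin.loc v = (𝔩 v).xiH ((GlobalPacketH.rhoXiU h8U ξ').loc v)

/-- **(γ) `InnerFormATransportLetter₃At L ι H T hT μ μω hμu 𝔩 h8U hunrU` — THE A-TRANSPORT, Q-FREE IMAGE FORM, AT ONE FRAME** (S5-R13 (2)) [Thm. 14.6.4 pp. 243–244 «`Π′ ∈ Π_a(G′)`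
⇒ `Π′ = Π′(ξ)`, `Π′(ξ)_v = Π(ξ_v)` for `v ∉ S₀`»; Thm. 13.3.7] — OWNERS S9 (row (γ2) `hRigXi`, the §14.6 organ; hand-over ★ p864181) + S4 (row (γ1) `hEvpXi`, the (R-c) e.v.p.
dictionary, JQ-S5→S4-11); PAYER SHAPE ★ p864272 `exists_memXiFamily_of_evpRepOf_imageG_of_rows_qs` (via ★ p864070 (γ-a)): for `L`, `ι`, the inner form `(H, T, hT)` with measure `μ`
and the unitary Hecke character `μω`, AT THE FRAME `(𝔩, h8U, hunrU)`: a discrete `P` of `U(H)` with `t(P) = t(Π(ξ′))` — ★ `evpRepOf` against the image family of ★ W1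
`rhoXiU h8U ξ′` — lies in a ξ-envelope ★ `MemXiFamily … μω hμu ξ` (payers may take `ξ := ξ′`).  FRAME-PARAMETRIC AT THE FINEST GRAIN (S5-R18; J-A3-REC).
[cite: Rogawski1990, §14.6 Thm. 14.6.4 pp. 243–244, (14.6.3); §13.3 Thm. 13.3.7 pp. 202–203; §15.3 ¶1 p. 249] -/
def InnerFormATransportLetter₃At (L : Type) [Field L] [NumberField L] [IsCMField L] (ι : L →+* ℂ) (H : Matrix (Fin 3) (Fin 3) L) (T : GL (Fin 3) ℂ)
    (hT : (T : Matrix (Fin 3) (Fin 3) ℂ)ᴴ * H.map ι * (T : Matrix (Fin 3) (Fin 3) ℂ) = Literature.Geometry.ComplexHyperbolic.BallModel.J)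
    (μ : Measure (adelicGroupData (↥(maximalRealSubfield L)) L (IsCMField.complexConj L) 3 H).automorphicQuotient)
    [(adelicGroupData (↥(maximalRealSubfield L)) L (IsCMField.complexConj L) 3 H).IsAutomorphicMeasure μ]
    (μω : HeckeCharacter L) (hμu : μω.IsUnitary)
    (𝔩 : ∀ v : HeightOneSpectrum (𝓞 ↥(maximalRealSubfield L)), LocalPacketKit L (splitForm L 3) v)
    (h8U : ∀ v : HeightOneSpectrum (𝓞 ↥(maximalRealSubfield L)), (𝔩 v).OneDimHLawU)
    (hunrU : ∀ ξ : OneDimAutRepH L,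
      ∀ᶠ v : HeightOneSpectrum (𝓞 ↥(maximalRealSubfield L)) in cofinite, (𝔩 v).unr ((𝔩 v).xiH ((GlobalPacketH.rhoXiU h8U ξ).loc v))) : Prop :=
  ∀ (P : DiscreteAutomorphicRep (adelicGroupData (↥(maximalRealSubfield L)) L (IsCMField.complexConj L) 3 H) μ) (ξ' : OneDimAutRepH L),
    InnerFormSec146.evpRepOf L H μ 𝔩 P ((GlobalPacketH.rhoXiU h8U ξ').imageG (hunrU ξ')) →
      ∃ ξ : OneDimAutRepH L,
        MemXiFamily P (transpose_map_cmConjRingHom_eq_of_frame L ι H T hT) (isUnit_det_of_frame L ι H T hT) μω hμu ξ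

/-- **`ArchJLettersAtSomeFrame₃` — THE SOCKET-FACING HYPOTHESIS OF THE COMPOSITION: «for every datum of A's ₃-prefix up to `hμω`, SOME frame carries the three letters»**
(J-A3-REC).  For every CM `L` with `[L⁺ : ℚ] ≥ 3`, real place `ι`, inner form `(H, T, hT)` of signature `(2,1)` at `ι` and definite elsewhere, automorphic measure `μ`, and
unitary Hecke character `μω` restricting to `ω_{L∕L⁺}`, THERE IS a frame `(𝔩, h8U, hunrU, 𝔞, μqs, Pk)` over `Φ₃ = splitForm L 3` at which (α), (β), (γ) hold.  Fed, at the
frame of record, by the three payers (S9's (α); S5's (β) = ★ p864086 + ★ p864229 (T2) mod D ED. 5's row; S9+S4's (γ) = ★ p864272 mod rows) — whether the record's transfer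
data come as closed terms, by `Classical.choice` from existence theorems, or from D-style closed-∀-frame sockets over an `Hrec`-style record.  A DEFINITION (no socket here).
[cite: Rogawski1990, §15.3 ¶1 p. 249; §14.6 (14.6.2) p. 242, Prop. 14.6.2, Thm. 14.6.4 pp. 243–244; §13.3 Thm. 13.3.6 (c) p. 202] -/
def ArchJLettersAtSomeFrame₃ : Prop :=
  ∀ (L : Type) [Field L] [NumberField L] [IsCMField L] (ι : L →+* ℂ) (H : Matrix (Fin 3) (Fin 3) L) (T : GL (Fin 3) ℂ)
    (hT : (T : Matrix (Fin 3) (Fin 3) ℂ)ᴴ * H.map ι * (T : Matrix (Fin 3) (Fin 3) ℂ) = Literature.Geometry.ComplexHyperbolic.BallModel.J),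
    (∀ τ' : L →+* ℂ, InfinitePlace.mk τ' ≠ InfinitePlace.mk ι → (H.map τ').PosDef) →
    2 ≤ Module.finrank ℚ ↥(maximalRealSubfield L) →
    3 ≤ Module.finrank ℚ ↥(maximalRealSubfield L) →
    ∀ (μ : Measure (adelicGroupData (↥(maximalRealSubfield L)) L (IsCMField.complexConj L) 3 H).automorphicQuotient)
      [(adelicGroupData (↥(maximalRealSubfield L)) L (IsCMField.complexConj L) 3 H).IsAutomorphicMeasure μ]
      (μω : HeckeCharacter L) (hμu : μω.IsUnitary),
      (∀ x : Literature.NumberTheory.GaloisRepresentations.ideleGroup ↥(maximalRealSubfield L),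
        μω (AdeleRing.ideleBaseChange (↥(maximalRealSubfield L)) L x) = quadraticHeckeCharCM L x) →
    ∃ (𝔩 : ∀ v : HeightOneSpectrum (𝓞 ↥(maximalRealSubfield L)), LocalPacketKit L (splitForm L 3) v)
      (h8U : ∀ v : HeightOneSpectrum (𝓞 ↥(maximalRealSubfield L)), (𝔩 v).OneDimHLawU)
      (hunrU : ∀ ξ : OneDimAutRepH L,
        ∀ᶠ v : HeightOneSpectrum (𝓞 ↥(maximalRealSubfield L)) in cofinite, (𝔩 v).unr ((𝔩 v).xiH ((GlobalPacketH.rhoXiU h8U ξ).loc v)))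
      (𝔞 : ArchPacketKit) (_ : Nonempty 𝔞.PktInf)
      (μqs : Measure (adelicGroupData (↥(maximalRealSubfield L)) L (IsCMField.complexConj L) 3 (splitForm L 3)).automorphicQuotient)
      (_ : (adelicGroupData (↥(maximalRealSubfield L)) L (IsCMField.complexConj L) 3 (splitForm L 3)).IsAutomorphicMeasure μqs)
      (Pk : OneDimAutRepH L → ∀ v : HeightOneSpectrum (𝓞 ↥(maximalRealSubfield L)), CMLocalAPacket L (splitForm L 3) v),
      InnerFormEvpMatchLetter₃At L ι H T hT μ 𝔩 𝔞 μqs Pk ∧ QsArchJExhaustionLetter₃At L ι 𝔩 h8U 𝔞 μqs Pk ∧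
        InnerFormATransportLetter₃At L ι H T hT μ μω hμu 𝔩 h8U hunrU

/-- **THE COMPOSITION (α) ∘ (β) ∘ (γ) ⟹ (G∞)₃, PROVED** (RULING S5-R13's eight lines; S5-R18 ∕ J-A3-REC: the letters are consumed at SOME frame per datum — they are PAID at the
frame of record, where S4's law rows make them true; `stub_R90_1336c_membership₃` (A :254) is then ONE line, Lines-side).  (α) gives the matched packet `Q` with `t(P) = t(Q)` and
the occurring member with the `[J^δ]` token; (β) makes `Q` almost everywhere `Π(ξ′)`; ★ p864229 (T1) `evpRepOf_of_eventuallyEq_loc` transports `t(P) = t(Q)` to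
`t(P) = t(Π(ξ′))` (★ `GlobalPacketH.imageG_loc`); (γ) puts `P` in a ξ-envelope.  No 13.3.5, no archimedean slot.  No sorry; axioms TRIO.
[cite: Rogawski1990, §15.3 ¶1 p. 249; §14.6 (14.6.2) p. 242, Prop. 14.6.2, Thm. 14.6.4 pp. 243–244; §13.3 Thm. 13.3.6 (c) p. 202] -/
theorem xiMembershipOfArchJ₃_of_letters (h : ArchJLettersAtSomeFrame₃) : XiMembershipOfArchJLetter₃ := by
  intro L _ _ _ ι H T hT hdef h2 h3 μ _ μω hμu hμω P M _ _ σK σ𝔤 hM htok δ hδ hcls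
  -- the frame carrying the three letters at this datum
  obtain ⟨𝔩, h8U, hunrU, 𝔞, _, μqs, _, Pk, hα, hβ, hγ⟩ := h L ι H T hT hdef h2 h3 μ μω hμu hμω
  -- (α): the matched packet of record and the occurring member carrying the `[J^δ]` token
  obtain ⟨Q, hevp, hocc⟩ := hα P M σK σ𝔤 hM htok δ hδ hcls
  -- (β): the packet is almost everywhere `Π(ξ′)`
  obtain ⟨ξ', hae⟩ := hβ Q δ hδ hocc
  -- transport of the e.v.p. along the a.e. equality ((T1) ★ p864229), then (γ)
  have hae' : ∀ᶠ v : HeightOneSpectrum (𝓞 ↥(maximalRealSubfield L)) in cofinite,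
      Q.1.fin.loc v = ((GlobalPacketH.rhoXiU h8U ξ').imageG (hunrU ξ')).loc v :=
    hae.mono fun v hv => by rw [GlobalPacketH.imageG_loc]; exact hv
  exact hγ P ξ' (evpRepOf_of_eventuallyEq_loc L H μ 𝔩 P hevp hae')

/-- **(G∞)₃, `H¹`-TRIGGER FORM** (mirror of A §3 `xiMembership_of_cohUnitaryToken` at the two-place letter, for B's ED. 3 `s2Fin_of_spine₃`): a coh-unitary token with a non-zero
degree-one class of type `δ` suffices (★ `ofModule_eq_archDegOneClass`).  No sorry. [cite: Rogawski1990, Prop. 15.2.1 (b) (p. 250); §15.3 ¶1 (p. 249)] [cite: BorelWallach2000, VI Thm. 4.11] -/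
theorem xiMembership₃_of_cohUnitaryToken (hG : XiMembershipOfArchJLetter₃)
    (L : Type) [Field L] [NumberField L] [IsCMField L] (ι : L →+* ℂ) (H : Matrix (Fin 3) (Fin 3) L) (T : GL (Fin 3) ℂ)
    (hT : (T : Matrix (Fin 3) (Fin 3) ℂ)ᴴ * H.map ι * (T : Matrix (Fin 3) (Fin 3) ℂ) = Literature.Geometry.ComplexHyperbolic.BallModel.J)
    (hdef : ∀ τ' : L →+* ℂ, InfinitePlace.mk τ' ≠ InfinitePlace.mk ι → (H.map τ').PosDef)
    (h2 : 2 ≤ Module.finrank ℚ ↥(maximalRealSubfield L)) (h3 : 3 ≤ Module.finrank ℚ ↥(maximalRealSubfield L))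
    (μ : Measure (adelicGroupData (↥(maximalRealSubfield L)) L (IsCMField.complexConj L) 3 H).automorphicQuotient)
    [(adelicGroupData (↥(maximalRealSubfield L)) L (IsCMField.complexConj L) 3 H).IsAutomorphicMeasure μ]
    (μω : HeckeCharacter L) (hμu : μω.IsUnitary)
    (hμω : ∀ x : Literature.NumberTheory.GaloisRepresentations.ideleGroup ↥(maximalRealSubfield L),
      μω (AdeleRing.ideleBaseChange (↥(maximalRealSubfield L)) L x) = quadraticHeckeCharCM L x)
    (P : DiscreteAutomorphicRep (adelicGroupData (↥(maximalRealSubfield L)) L (IsCMField.complexConj L) 3 H) μ)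
    (M : Type) [AddCommGroup M] [Module ℂ M] (σK : Representation ℂ (uFormGroup (Fin 2) (Fin 1)).maximalCompact M)
    (σ𝔤 : (uFormGroup (Fin 2) (Fin 1)).lie →ₗ⁅ℝ⁆ Module.End ℂ M) (hM : IsCohUnitaryIrrep σK σ𝔤)
    (htok : ∃ T₁ : P.archModuleCM ι T hT →ₗ[ℂ] M,
        (∀ (k : (uFormGroup (Fin 2) (Fin 1)).maximalCompact) (w : P.archModuleCM ι T hT),
            T₁ (P.archRepKCM ι T hT k w) = σK k (T₁ w)) ∧
          (∀ (X : (uFormGroup (Fin 2) (Fin 1)).lie) (w : P.archModuleCM ι T hT),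
            T₁ (P.archRepLieCM ι T hT X w) = σ𝔤 X (T₁ w)) ∧ T₁ ≠ 0)
    (δ : ℤ) (hδ : δ = 1 ∨ δ = -1) (hne : upqTypeClasses σK σ𝔤 hM.gk.ad_compat 1 δ ≠ ⊥) :
    ∃ ξ : OneDimAutRepH L,
      MemXiFamily P (transpose_map_cmConjRingHom_eq_of_frame L ι H T hT) (isUnit_det_of_frame L ι H T hT) μω hμu ξ :=
  hG L ι H T hT hdef h2 h3 μ μω hμu hμω P M σK σ𝔤 hM htok δ hδ (ofModule_eq_archDegOneClass σK σ𝔤 hM δ hδ hne)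

end A3Letters

end Summit.HodgeConjecture.HodgeConjecture.R90.S5

end
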